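import Literature.GroupTheory.CombinatorialGroupTheory.AutFreeGroupAbelianisation
import HarnessLib

/-!
# Stub `stub_autFreeGroupRealisesGL` of line `epi-class-livingston` for crux `CongruenceShadows.ShadowApproximation`
(item stmt-SmoothPoincare4-14595, route route-SmoothPoincare4-CongruenceShadows)

**Every invertible integer `3 × 3` matrix is the abelianisation of an automorphism of `F₃`.**
For `M : Matrix (Fin 3) (Fin 3) ℤ` with `det M = ±1` there is `θ : F₃ ≃* F₃` such that row `i`
of `M` is the exponent-sum vector of `θ xᵢ`, the exponent sums being read off through the
coordinate abelianisation map
`FreeGroup.lift (k ↦ ofAdd (Pi.single k 1)) : F₃ →* Multiplicative (Fin 3 → ℤ)`.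

This is the case `ι = Fin 3` of the Literature theorem
`Literature.GroupTheory.CombinatorialGroupTheory.exists_mulEquiv_toAdd_lift_apply_eq`
(`Literature/GroupTheory/CombinatorialGroupTheory/AutFreeGroupAbelianisation.lean`): the natural
map `Aut Fₙ → Aut (Fₙ / [Fₙ, Fₙ]) ≅ GLₙ(ℤ)` is onto (Nielsen 1924; Lyndon–Schupp,
*Combinatorial Group Theory* (2001), Ch. I Prop. 4.4), proved there from the generation of
`GLₙ(ℤ)` by the transvections `1 ± E_{ij}` and the sign changes
(`Literature.LinearAlgebra.Matrix.intElementary_induction_left`), which are the matrices of the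
elementary Nielsen automorphisms `xᵢ ↦ xᵢ xⱼ^{±1}`, `xᵢ ↦ xᵢ⁻¹`, composition of automorphisms
multiplying the matrices.

In the line this is step 1b of the dictionary at genus `3`: the change-of-framing matrices
`c̄ᵢ ∈ GL₃(ℤ)` on `H₁` of the three standard handlebody groups `S₃ ⧸ Nᵢ ≅ F₃` lift to
automorphisms of `F₃`.
-/

-- the prescribed namespace `Summit.<P>.<Sub>.…` duplicates `SmoothPoincare4` (P = Sub)
set_option linter.dupNamespace false

namespace Summit.SmoothPoincare4.SmoothPoincare4.Theorems.ShadowApproximation.EpiClassLivingston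

/-- **Stub 1b of line `epi-class-livingston`: `Aut F₃ → GL₃(ℤ)` is onto, in coordinates.**  For
every integer `3 × 3` matrix `M` of determinant `±1` there is an automorphism `θ` of the free
group `F₃ = F(x₀, x₁, x₂)` such that, for all `i j`, the total exponent of `xⱼ` in `θ xᵢ` is
`M i j` (row `i` of `M` = exponent-sum vector of `θ xᵢ`).  The case `ι = Fin 3` of
`Literature.GroupTheory.CombinatorialGroupTheory.exists_mulEquiv_toAdd_lift_apply_eq`
(Lyndon–Schupp, Ch. I Prop. 4.4; Nielsen 1924). [folklore] -/
theorem stub_autFreeGroupRealisesGL :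
    ∀ M : Matrix (Fin 3) (Fin 3) ℤ, IsUnit M.det →
      ∃ θ : FreeGroup (Fin 3) ≃* FreeGroup (Fin 3), ∀ i j : Fin 3,
        Multiplicative.toAdd (FreeGroup.lift
          (fun k : Fin 3 => Multiplicative.ofAdd (Pi.single k (1 : ℤ) : Fin 3 → ℤ))
          (θ (FreeGroup.of i))) j = M i j :=
  fun M hM =>
    Literature.GroupTheory.CombinatorialGroupTheory.exists_mulEquiv_toAdd_lift_apply_eq M hM

end Summit.SmoothPoincare4.SmoothPoincare4.Theorems.ShadowApproximation.EpiClassLivingston
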